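import Mathlib
import Summits.NavierStokesRegularity.NavierStokesRegularity.Theorems.L3TimeExponentPincerEffSatBlowupStubParabolicConcentrationBlowup
import HarnessLib.Audit
import HarnessLib

/-!
# Forward modulation of the worst-ball scaled energy at every scale — a DYNAMICAL a priori bound
# for the frame (route `L3TimeExponentPincer`, crux `L3CascadeJaw`, stmt-NavierStokesRegularity-19499)

Support file for the parent crux `L3CascadeJaw` (cell ns-regularity-ideate, seat nsreg-p4 gen 6).  The route's
Morrey programme (J′, J″, J‴, the coupled clock) decides the crux on RATE classes of the worst-ball scaled energy
`Φ_r(t) = sup_x r⁻¹ ∫_{B(x,r)} |u(t)|²`; the planner's ROUND-10/11 reading is that the first bite `∃ q > 4` must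
come from DYNAMICS — a statement bounding how fast `Φ` can move ("the «cannot idle» statement in Ψ-currency",
nsreg-p2 g12, ROUND-11 seed 4b: "a one-sided modulation inequality for Φ from the local energy inequality on the
worst ball").  This file lands the one such statement that IS an a priori theorem — the Lemarié-Rieusset /
Jia–Šverák local-energy a priori estimate, transported to EVERY scale `r` and EVERY interior time `t₀` of the
route's frame by Seregin's rescaled restart:

* `exists_scaledEnergy_modulation` — **absolute `ε₁ > 0`, `C₁ ≥ 1` such that for every frame solution
  (`ν, T > 0`, classical on `[0,T)`, Leray–Hopf from a rapidly decaying datum), every `t₀ ∈ (0,T)`, `r > 0`,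
  `A > 0`: if `∫_{B(x,r)} |u(t₀)|² ≤ A r` for ALL centres `x`, then `∫_{B(x,r)} |u(t)|² ≤ C₁ A r` for all centres
  and all `t ∈ [t₀, T)` with `t - t₀ < ε₁ r² min(ν⁻¹, ν³/A²)`.**  In words: the worst-ball scaled energy at scale
  `r` cannot grow by more than the absolute factor `C₁` within the CAUSAL WINDOW `ε₁ r² min(1/ν, ν³/Φ_r(t₀)²)`;
  its local clock runs no faster than `Φ_r² /(ν³ r²)` (or the viscous rate `ν/r²`).
* `exists_scaledEnergy_backward` — the contrapositive, the form a blow-up analysis consumes: if at time `t` some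
  ball of radius `r` carries `∫_{B(x,r)} |u(t)|² > C₁ A r`, then at EVERY earlier time `t₀ ∈ (0,t]` inside the
  causal window some ball of the same radius already carried `> A r` — **concentration has a past**.

Proof (all inputs are tree theorems): interior regularity of the frame (`eLpNorm_top_Icc_lt_top_of_frame`,
Tao 2013 closed-slab bounds) ⇒ Seregin's rescaled restart at `(t₀, x)`, scale `r`, unit viscosity
(`IsLerayHopfOn.exists_isLocalEnergySolutionOn_rescaled_restart`: `U(s,y) = (r/ν) u(t₀ + r²s/ν, x + r y)` is a
local energy solution on `(0, ν(T-t₀)/r²)`), whose datum has unit-ball energies `≤ A/ν²`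
(`setLIntegral_preimage_comp_space_affine`); Jia–Šverák 2014 Lemma 3.1 at unit scale
(`JiaSverak2014.apriori_unit_scale_slab`, absolute `ε₀, C`) bounds the unit-ball energies of `U(s)` by `C A/ν²`
for a.e. `s ∈ (0,S')`, `S' = min(ε₀ min(1, 4ν⁴/A²), ν(T-t₀)/r²)`; transport back (`ae_restrict_Ioo_comp_time_affine`)
and upgrade "a.e. `t`" to "every `t`" by the continuity of `t ↦ ∫_{B̄(x,r)} |u(t)|²` for the classical solution
(`continuous_parametric_integral_of_continuous`).

Calibration (docstrings only).  Eddy of size `r`, velocity `U`: `Φ_r ≍ U² r²`, causal window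
`≍ r² ν³/Φ_r² = (r/U) · Re_r^{-3}` with `Re_r = U r/ν` — the energy-class clock is slower than the Euler turn-over
time `r/U` by `Re_r³`; the crux's Euler-speed law would be the same statement with window `≍ r/U`.  Any
improvement of the exponent `2` of `Φ_r` in the window is supercritical information.
References: H. Jia, V. Šverák, Invent. Math. 196 (2014), Lemma 3.1 (= Jia–Šverák 2013 Lemma 2; Lemarié-Rieusset
2002, the local energy a priori estimate); K. Kang, H. Miura, T.-P. Tsai, IMRN 2021, Lemma 3.5; G. Seregin,
CMP 312 (2012) §2 (rescaled restart).
WHAT THIS IS NOT: not a claim about Navier–Stokes regularity or blow-up and not progress on the crux beyond the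
energy class: a kernel-checked a priori estimate in the crux's exact frame, landed `--supports` as a helper.
-/

noncomputable section

namespace Summit.NavierStokesRegularity.NavierStokesRegularity.Theorems.L3TimeExponentPincerScaledEnergyModulation

open MeasureTheory Set Function Filter Metric Topology TopologicalSpace
open scoped ENNReal NNReal
open Literature.Analysis.FluidPDE
open Summit.NavierStokesRegularity.NavierStokesRegularity.Theorems.L3TimeExponentPincerStubParabolicConcentration
  (eLpNorm_top_Icc_lt_top_of_frame)

/-! ## §1  Real-variable helpers: a.e. bounds for continuous functions; ball vs closed ball -/

/-- A function continuous on `[a,b]` (`a < b`) and `≤ M` a.e. on `(a,b)` is `≤ M` everywhere on `[a,b]`. [folklore] -/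
theorem le_of_ae_le_of_continuousOn_Icc {g : ℝ → ℝ} {a b M : ℝ} (hab : a < b) (hg : ContinuousOn g (Icc a b))
    (hae : ∀ᵐ t ∂(volume.restrict (Ioo a b)), g t ≤ M) : ∀ t ∈ Icc a b, g t ≤ M := by
  intro t ht
  by_contra hlt
  rw [not_le] at hlt
  -- continuity within `[a,b]`: `g > M` on `[a,b] ∩ (t-δ, t+δ)`
  have hc := hg t ht
  have hev : ∀ᶠ s in 𝓝[Icc a b] t, M < g s := hc (Ioi_mem_nhds hlt)
  obtain ⟨δ, hδ, hball⟩ : ∃ δ > 0, ∀ s ∈ Icc a b, dist s t < δ → M < g s := by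
    obtain ⟨δ, hδ, h⟩ := Metric.mem_nhdsWithin_iff.1 hev
    exact ⟨δ, hδ, fun s hs hd => h ⟨hd, hs⟩⟩
  -- a nondegenerate open interval inside `(a,b) ∩ (t-δ,t+δ)`
  set a' : ℝ := max a (t - δ / 2) with ha'
  set b' : ℝ := min b (t + δ / 2) with hb'
  have ha'b' : a' < b' := by
    rw [ha', hb']
    refine max_lt (lt_min hab (by linarith [ht.1])) (lt_min (by linarith [ht.2]) (by linarith))
  have hsub : Ioo a' b' ⊆ Ioo a b := Ioo_subset_Ioo (le_max_left _ _) (min_le_left _ _)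
  have hpos : 0 < volume (Ioo a' b') := by rw [Real.volume_Ioo]; exact ENNReal.ofReal_pos.2 (by linarith)
  have hzero : volume (Ioo a' b') = 0 := by
    have h1 : ∀ᵐ s ∂(volume : Measure ℝ), s ∈ Ioo a b → g s ≤ M := (ae_restrict_iff' measurableSet_Ioo).1 hae
    refine measure_mono_null (fun s hs => ?_) (ae_iff.1 h1)
    intro hs'
    have hsab : s ∈ Ioo a b := hsub hs
    have hd : dist s t < δ := by
      rw [Real.dist_eq, abs_lt]
      have h2 : t - δ / 2 ≤ a' := le_max_right _ _
      have h3 : b' ≤ t + δ / 2 := min_le_right _ _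
      constructor <;> linarith [hs.1, hs.2]
    exact (hs' hsab).not_gt (hball s (Ioo_subset_Icc_self hsab) hd)
  exact hpos.ne' hzero

/-- `∫_{B̄(x,r)} f = ∫_{B(x,r)} f` for Lebesgue measure on `ℝ³` (spheres are null). [folklore] -/
theorem setLIntegral_closedBall_eq_ball (f : EuclideanSpace ℝ (Fin 3) → ℝ≥0∞) (x : EuclideanSpace ℝ (Fin 3)) (r : ℝ) :
    ∫⁻ y in closedBall x r, f y = ∫⁻ y in ball x r, f y := by
  refine setLIntegral_congr ?_
  refine (ae_eq_of_subset_of_measure_ge ball_subset_closedBall ?_ measurableSet_ball.nullMeasurableSet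
    measure_closedBall_lt_top.ne).symm
  rw [Measure.addHaar_closedBall_eq_addHaar_ball]

/-! ## §2  Continuity in time of closed-ball energies of the classical solution -/

/-- **`t ↦ ∫_{B̄(x,r)} |u(t)|²` is continuous on every `[a,b] ⊂ [0,T)`** for a field jointly continuous on
`[0,T) × ℝ³` (uniform continuity on the compact `[a,b] × B̄(x,r)`; Mathlib's
`continuous_parametric_integral_of_continuous` applied to the extension `u ∘ projIcc`). [folklore] -/
theorem continuousOn_integral_closedBall_sq {T : ℝ} {u : ℝ → EuclideanSpace ℝ (Fin 3) → EuclideanSpace ℝ (Fin 3)}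
    (hu : ContinuousOn (uncurry u) (Ico 0 T ×ˢ univ)) {a b : ℝ} (hab : a ≤ b) (ha : 0 ≤ a) (hb : b < T)
    (x : EuclideanSpace ℝ (Fin 3)) (r : ℝ) :
    ContinuousOn (fun t => ∫ y in closedBall x r, ‖u t y‖ ^ 2) (Icc a b) := by
  -- the extension `ũ(t, y) = u(projIcc a b t, y)`, jointly continuous on `ℝ × ℝ³`
  set v : ℝ → EuclideanSpace ℝ (Fin 3) → EuclideanSpace ℝ (Fin 3) := fun t y => u (projIcc a b hab t) y with hv
  have hφ : Continuous fun z : ℝ × EuclideanSpace ℝ (Fin 3) => (((projIcc a b hab z.1 : Icc a b) : ℝ), z.2) :=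
    (continuous_subtype_val.comp (continuous_projIcc.comp continuous_fst)).prodMk continuous_snd
  have hmaps : ∀ z : ℝ × EuclideanSpace ℝ (Fin 3),
      (((projIcc a b hab z.1 : Icc a b) : ℝ), z.2) ∈ Ico 0 T ×ˢ (univ : Set (EuclideanSpace ℝ (Fin 3))) := by
    intro z
    have hm := (projIcc a b hab z.1).2
    exact ⟨⟨ha.trans hm.1, lt_of_le_of_lt hm.2 hb⟩, mem_univ _⟩
  have hvc : Continuous (uncurry v) := by
    have : uncurry v = uncurry u ∘ fun z : ℝ × EuclideanSpace ℝ (Fin 3) =>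
        (((projIcc a b hab z.1 : Icc a b) : ℝ), z.2) := by
      funext z; rfl
    rw [this]
    exact hu.comp_continuous hφ hmaps
  have hF : Continuous (uncurry fun t y => ‖v t y‖ ^ 2) := by
    have : (uncurry fun t y => ‖v t y‖ ^ 2) = fun z => ‖uncurry v z‖ ^ 2 := by funext z; rfl
    rw [this]
    exact hvc.norm.pow 2
  have hG : Continuous fun t => ∫ y in closedBall x r, ‖v t y‖ ^ 2 :=
    continuous_parametric_integral_of_continuous hF (isCompact_closedBall x r)
  refine hG.continuousOn.congr fun t ht => ?_
  -- on `[a,b]` the extension is `u` itself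
  show ∫ y in closedBall x r, ‖u t y‖ ^ 2 = ∫ y in closedBall x r, ‖v t y‖ ^ 2
  have : v t = u t := by
    funext y
    rw [hv]
    simp only [projIcc_of_mem hab ht]
  rw [this]

/-- The closed-ball energy as a real integral: `∫⁻_{B̄} ‖u(t)‖ₑ² = ofReal (∫_{B̄} ‖u(t)‖²)` for a continuous slice. -/
theorem lintegral_closedBall_eq_ofReal_integral {w : EuclideanSpace ℝ (Fin 3) → EuclideanSpace ℝ (Fin 3)}
    (hw : Continuous w) (x : EuclideanSpace ℝ (Fin 3)) (r : ℝ) :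
    ∫⁻ y in closedBall x r, ‖w y‖ₑ ^ 2 = ENNReal.ofReal (∫ y in closedBall x r, ‖w y‖ ^ 2) := by
  have hint : IntegrableOn (fun y => ‖w y‖ ^ 2) (closedBall x r) volume :=
    (hw.norm.pow 2).continuousOn.integrableOn_compact (isCompact_closedBall x r)
  rw [ofReal_integral_eq_lintegral_ofReal hint (Eventually.of_forall fun y => by positivity)]
  refine lintegral_congr fun y => ?_
  rw [← ofReal_norm, ENNReal.ofReal_pow (norm_nonneg _)]

/-! ## §3  The transport identity for ball energies under Seregin's rescaling -/

/-- Unit-ball energies of the rescaled field `y ↦ (r/ν) w(x + r y)` are the scaled energies of `w` at scale `r`: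
`∫_{B(y₀,1)} |(r/ν) w(x + r y)|² dy = (r/ν)² r⁻³ ∫_{B(x + r y₀, r)} |w|²`. -/
theorem lintegral_unitBall_rescaled (w : EuclideanSpace ℝ (Fin 3) → EuclideanSpace ℝ (Fin 3)) {ν r : ℝ}
    (hν : 0 < ν) (hr : 0 < r) (x y₀ : EuclideanSpace ℝ (Fin 3)) :
    ∫⁻ y in ball y₀ 1, ‖(r / ν) • w (x + r • y)‖ₑ ^ 2 =
      ENNReal.ofReal (r / ν) ^ 2 * (ENNReal.ofReal (r ^ 3)⁻¹ * ∫⁻ z in ball (x + r • y₀) r, ‖w z‖ₑ ^ 2) := by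
  have hq : 0 ≤ r / ν := by positivity
  have e1 : ∀ y : EuclideanSpace ℝ (Fin 3), ‖(r / ν) • w (x + r • y)‖ₑ ^ 2 =
      ENNReal.ofReal (r / ν) ^ 2 * ‖w (x + r • y)‖ₑ ^ 2 := fun y => by
    rw [enorm_smul, mul_pow, Real.enorm_eq_ofReal hq]
  simp_rw [e1]
  rw [lintegral_const_mul' _ _ (ENNReal.pow_ne_top ENNReal.ofReal_ne_top)]
  have e2 : ball y₀ 1 = (fun y : EuclideanSpace ℝ (Fin 3) => x + r • y) ⁻¹' ball (x + r • y₀) (r * 1) :=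
    (space_affine_preimage_ball_add_smul hr x y₀ 1).symm
  rw [e2, setLIntegral_preimage_comp_space_affine hr x (fun z => ‖w z‖ₑ ^ 2) (ball (x + r • y₀) (r * 1)),
    finrank_euclideanSpace_fin, mul_one]

/-- The scale factors: `(r/ν)² (r³)⁻¹ (B r) = B/ν²` in `ℝ≥0∞`. -/
theorem rescale_factor_mul {ν r : ℝ} (B : ℝ) (hν : 0 < ν) (hr : 0 < r) :
    ENNReal.ofReal (r / ν) ^ 2 * (ENNReal.ofReal (r ^ 3)⁻¹ * ENNReal.ofReal (B * r)) = ENNReal.ofReal (B / ν ^ 2) := by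
  rw [← ENNReal.ofReal_pow (by positivity), ← ENNReal.ofReal_mul (by positivity),
    ← ENNReal.ofReal_mul (by positivity)]
  congr 1
  field_simp

/-- Inverting the scale factors: from `(r/ν)² (r³)⁻¹ X ≤ ofReal (B/ν²)` to `X ≤ ofReal (B r)`. -/
theorem le_of_rescale_factor_mul_le {ν r B : ℝ} (hν : 0 < ν) (hr : 0 < r) {X : ℝ≥0∞}
    (h : ENNReal.ofReal (r / ν) ^ 2 * (ENNReal.ofReal (r ^ 3)⁻¹ * X) ≤ ENNReal.ofReal (B / ν ^ 2)) :
    X ≤ ENNReal.ofReal (B * r) := by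
  have hc : ENNReal.ofReal (r / ν) ^ 2 * ENNReal.ofReal (r ^ 3)⁻¹ = ENNReal.ofReal ((r / ν) ^ 2 * (r ^ 3)⁻¹) := by
    rw [← ENNReal.ofReal_pow (by positivity), ← ENNReal.ofReal_mul (by positivity)]
  have hcpos : 0 < (r / ν) ^ 2 * (r ^ 3)⁻¹ := by positivity
  rw [← mul_assoc, hc] at h
  have h2 : X ≤ ENNReal.ofReal (B / ν ^ 2) / ENNReal.ofReal ((r / ν) ^ 2 * (r ^ 3)⁻¹) := by
    rw [ENNReal.le_div_iff_mul_le (Or.inl (ENNReal.ofReal_pos.2 hcpos).ne') (Or.inl ENNReal.ofReal_ne_top),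
      mul_comm]
    exact h
  refine h2.trans (le_of_eq ?_)
  rw [← ENNReal.ofReal_div_of_pos hcpos]
  congr 1
  field_simp

/-! ## §4  The modulation theorem -/

/-- **Forward modulation of the worst-ball scaled energy at every scale (Jia–Šverák 2014 Lemma 3.1 for the
frame).**  There are absolute constants `ε₁ > 0` and `C₁ ≥ 1` such that: for every `ν, T > 0`, every classical
solution `(u,p)` of the unforced system on `ℝ³ × [0,T)` which is Leray–Hopf on `[0,T)` from its rapidly decaying
datum, every `t₀ ∈ (0,T)`, every scale `r > 0` and every level `A > 0` with
`∫_{B(x,r)} |u(t₀)|² ≤ A·r` for ALL centres `x`, one has `∫_{B(x,r)} |u(t)|² ≤ C₁·A·r` for all centres `x` and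
all times `t ∈ [t₀,T)` with `t - t₀ < ε₁ r² min(ν⁻¹, ν³/A²)`.  (`ε₁, C₁` = the constants `ε₀, max C 1` of
`JiaSverak2014.apriori_unit_scale_slab`.)
[cite: JiaSverak2014, Lemma 3.1 (arXiv:1204.0529 p. 7)] [cite: KangMiuraTsai2020, Lemma 3.5]
[cite: Seregin2012CMP, §2 (2.3)–(2.4)] -/
theorem exists_scaledEnergy_modulation :
    ∃ ε₁ : ℝ, 0 < ε₁ ∧ ∃ C₁ : ℝ, 1 ≤ C₁ ∧
      ∀ (ν T : ℝ), 0 < ν → 0 < T →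
      ∀ (u : ℝ → EuclideanSpace ℝ (Fin 3) → EuclideanSpace ℝ (Fin 3)) (p : ℝ → EuclideanSpace ℝ (Fin 3) → ℝ),
        IsClassicalNSSolutionOn (Ico 0 T) ν 0 u p → IsLerayHopfOn T ν 0 (u 0) u → HasRapidSpatialDecay (u 0) →
        ∀ t₀ ∈ Ioo 0 T, ∀ r : ℝ, 0 < r → ∀ A : ℝ, 0 < A →
          (∀ x : EuclideanSpace ℝ (Fin 3), ∫⁻ y in ball x r, ‖u t₀ y‖ₑ ^ 2 ≤ ENNReal.ofReal (A * r)) →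
          ∀ t ∈ Ico t₀ T, t - t₀ < ε₁ * r ^ 2 * min ν⁻¹ (ν ^ 3 / A ^ 2) →
            ∀ x : EuclideanSpace ℝ (Fin 3), ∫⁻ y in ball x r, ‖u t y‖ₑ ^ 2 ≤ ENNReal.ofReal (C₁ * A * r) := by
  obtain ⟨ε₀, hε₀, hε₀1, C, hAP⟩ := JiaSverak2014.apriori_unit_scale_slab
  have hε₀' : (0 : ℝ) < ε₀ := by exact_mod_cast hε₀
  refine ⟨ε₀, hε₀', max (C : ℝ) 1, le_max_right _ _, ?_⟩
  intro ν T hν hT u p hcl hLH hdec t₀ ht₀ r hr A hA hdat t ht hτ x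
  have hC₁ : (C : ℝ) ≤ max (C : ℝ) 1 := le_max_left _ _
  -- ### the trivial case `t = t₀`
  rcases eq_or_lt_of_le ht.1 with h0 | ht₀t
  · rw [← h0]
    refine (hdat x).trans (ENNReal.ofReal_le_ofReal ?_)
    have : A * r ≤ max (C : ℝ) 1 * (A * r) := le_mul_of_one_le_left (by positivity) (le_max_right _ _)
    linarith
  -- ### Seregin's rescaled restart at `(t₀, x)`, scale `r`, unit viscosity
  have hreg : ∀ s ∈ Ioo 0 T, ∀ y : EuclideanSpace ℝ (Fin 3), IsRegularPoint u (s, y) := fun s hs y =>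
    isRegularPoint_of_eLpNorm_Icc_lt_top (eLpNorm_top_Icc_lt_top_of_frame hν hcl hLH hdec) hs y
  obtain ⟨π, hU⟩ := hLH.exists_isLocalEnergySolutionOn_rescaled_restart hν hT hreg ht₀ hr x
  set Tsl : ℝ := ν * (T - t₀) / r ^ 2 with hTsl
  have hTt₀ : 0 < T - t₀ := sub_pos.2 ht₀.2
  have hTsl_pos : 0 < Tsl := by rw [hTsl]; positivity
  -- the datum: measurable with unit-ball energies `≤ A/ν² = 2α`
  have hcont_t₀ : Continuous (u t₀) := (hcl.contDiff_velocity ⟨ht₀.1.le, ht₀.2⟩).continuous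
  have hU₀m : AEStronglyMeasurable (fun y => (r / ν) • u t₀ (x + r • y)) volume := by
    have h1 : Continuous fun y : EuclideanSpace ℝ (Fin 3) => x + r • y := by fun_prop
    exact ((hcont_t₀.comp h1).const_smul (r / ν)).aestronglyMeasurable
  set α : ℝ≥0 := (A / (2 * ν ^ 2)).toNNReal with hα
  have hα_coe : (α : ℝ) = A / (2 * ν ^ 2) := Real.coe_toNNReal _ (by positivity)
  have h2α : 2 * (α : ℝ≥0∞) = ENNReal.ofReal (A / ν ^ 2) := by
    rw [← ENNReal.ofReal_coe_nnreal, hα_coe, ← ENNReal.ofReal_ofNat 2, ← ENNReal.ofReal_mul (by norm_num)]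
    congr 1
    field_simp
  have hU₀small : ∀ y₀ : EuclideanSpace ℝ (Fin 3),
      ∫⁻ y in ball y₀ 1, ‖(r / ν) • u t₀ (x + r • y)‖ₑ ^ 2 ≤ 2 * (α : ℝ≥0∞) := by
    intro y₀
    rw [lintegral_unitBall_rescaled (u t₀) hν hr x y₀, h2α, ← rescale_factor_mul A hν hr]
    gcongr
    exact hdat _
  -- a weak gradient of the restarted solution on its slab
  obtain ⟨G₁, hG₁, -, -⟩ := hU.suitable.localEnergy
  -- ### the JS window `S'` and Jia–Šverák's a priori estimate at unit scale
  set S' : ℝ := min ((ε₀ : ℝ) * min 1 (4 * ν ^ 4 / A ^ 2)) Tsl with hS'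
  have hS'pos : 0 < S' := lt_min (by positivity) hTsl_pos
  have hS'Tsl : S' ≤ Tsl := min_le_right _ _
  have hS'ε : S' ≤ (ε₀ : ℝ) :=
    (min_le_left _ _).trans (by nlinarith [min_le_left (1 : ℝ) (4 * ν ^ 4 / A ^ 2), hε₀'.le])
  have hS'α : S' * (α : ℝ) ^ 2 ≤ (ε₀ : ℝ) := by
    have h1 : S' ≤ (ε₀ : ℝ) * (4 * ν ^ 4 / A ^ 2) :=
      (min_le_left _ _).trans (mul_le_mul_of_nonneg_left (min_le_right _ _) hε₀'.le)
    have h2 : (α : ℝ) ^ 2 = A ^ 2 / (4 * ν ^ 4) := by rw [hα_coe]; field_simp; ring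
    rw [h2]
    calc S' * (A ^ 2 / (4 * ν ^ 4)) ≤ (ε₀ : ℝ) * (4 * ν ^ 4 / A ^ 2) * (A ^ 2 / (4 * ν ^ 4)) :=
          mul_le_mul_of_nonneg_right h1 (by positivity)
      _ = ε₀ := by field_simp
  obtain ⟨hE, -, -⟩ := hAP _ _ π G₁ α Tsl S' hU₀m hU.isLocalLeraySolutionOn hG₁ hU₀small hS'pos hS'Tsl hS'ε hS'α
  -- ### transport the a.e. bound back to `u` on the window `W = (t₀, t₀ + r² S'/ν)`
  set β : ℝ := r ^ 2 / ν with hβ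
  have hβpos : 0 < β := by rw [hβ]; positivity
  have hE' : ∀ᵐ s ∂(volume.restrict (Ioo 0 S')),
      ∫⁻ y in ball x r, ‖u (t₀ + β * s) y‖ₑ ^ 2 ≤ ENNReal.ofReal (C * A * r) := by
    filter_upwards [hE] with s hs
    have h1 := hs 0
    rw [lintegral_unitBall_rescaled (u (t₀ + r ^ 2 / ν * s)) hν hr x 0, smul_zero, add_zero] at h1
    have h2 : 2 * (((C * α : ℝ≥0)) : ℝ≥0∞) = ENNReal.ofReal (C * A / ν ^ 2) := by
      rw [ENNReal.coe_mul, mul_left_comm, h2α, ← ENNReal.ofReal_coe_nnreal, ← ENNReal.ofReal_mul C.coe_nonneg]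
      congr 1
      field_simp
    rw [h2] at h1
    exact le_of_rescale_factor_mul_le hν hr h1
  -- change of the time variable `t' = t₀ + β s`
  have hW : ∀ᵐ t' ∂(volume.restrict (Ioo t₀ (t₀ + β * S'))),
      ∫⁻ y in ball x r, ‖u t' y‖ₑ ^ 2 ≤ ENNReal.ofReal (C * A * r) := by
    have hβ' : 0 < β⁻¹ := inv_pos.2 hβpos
    have e1 : Ioo (-(β⁻¹ * t₀) + β⁻¹ * t₀) (-(β⁻¹ * t₀) + β⁻¹ * (t₀ + β * S')) = Ioo 0 S' := by
      congr 1
      · ring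
      · field_simp; ring
    have h := ae_restrict_Ioo_comp_time_affine hβ' (-(β⁻¹ * t₀)) t₀ (t₀ + β * S')
      (P := fun s => ∫⁻ y in ball x r, ‖u (t₀ + β * s) y‖ₑ ^ 2 ≤ ENNReal.ofReal (C * A * r)) (by rw [e1]; exact hE')
    filter_upwards [h] with t' ht'
    have e2 : t₀ + β * (-(β⁻¹ * t₀) + β⁻¹ * t') = t' := by field_simp; ring
    rwa [e2] at ht'
  -- ### the target time `t` lies in the window `(t₀, t₀ + β S')`
  have hmin : (ε₀ : ℝ) * r ^ 2 * min ν⁻¹ (ν ^ 3 / A ^ 2) ≤ β * ((ε₀ : ℝ) * min 1 (4 * ν ^ 4 / A ^ 2)) := by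
    have h1 : min ν⁻¹ (ν ^ 3 / A ^ 2) ≤ ν⁻¹ * min 1 (4 * ν ^ 4 / A ^ 2) := by
      rw [mul_min_of_nonneg _ _ (inv_nonneg.2 hν.le), mul_one]
      refine le_min (min_le_left _ _) ((min_le_right _ _).trans ?_)
      rw [div_le_iff₀ (by positivity)]
      field_simp
      nlinarith [pow_pos hν 3]
    calc (ε₀ : ℝ) * r ^ 2 * min ν⁻¹ (ν ^ 3 / A ^ 2) ≤ (ε₀ : ℝ) * r ^ 2 * (ν⁻¹ * min 1 (4 * ν ^ 4 / A ^ 2)) :=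
          mul_le_mul_of_nonneg_left h1 (by positivity)
      _ = β * ((ε₀ : ℝ) * min 1 (4 * ν ^ 4 / A ^ 2)) := by rw [hβ]; ring
  have hβS' : β * S' = min (β * ((ε₀ : ℝ) * min 1 (4 * ν ^ 4 / A ^ 2))) (T - t₀) := by
    rw [hS', mul_min_of_nonneg _ _ hβpos.le]
    congr 1
    rw [hβ, hTsl]
    field_simp
  have htW : t - t₀ < β * S' := by
    rw [hβS']
    exact lt_min (hτ.trans_le hmin) (by linarith [ht.2])
  -- ### a.e. on `(t₀, t)` ⟹ everywhere on `[t₀, t]` by continuity of the closed-ball energy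
  set g : ℝ → ℝ := fun t' => ∫ y in closedBall x r, ‖u t' y‖ ^ 2 with hg
  have hgc : ContinuousOn g (Icc t₀ t) :=
    continuousOn_integral_closedBall_sq hcl.smooth_velocity.continuousOn ht₀t.le ht₀.1.le ht.2 x r
  have hsub : Ioo t₀ t ⊆ Ioo t₀ (t₀ + β * S') := Ioo_subset_Ioo_right (by linarith)
  have hae : ∀ᵐ t' ∂(volume.restrict (Ioo t₀ t)), g t' ≤ C * A * r := by
    have h1 := ae_restrict_of_ae_restrict_of_subset hsub hW
    filter_upwards [h1, ae_restrict_mem measurableSet_Ioo] with t' ht' ht'I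
    have ht'c : t' ∈ Ico 0 T := ⟨(ht₀.1.trans ht'I.1).le, ht'I.2.trans ht.2⟩
    have hcont : Continuous (u t') := (hcl.contDiff_velocity ht'c).continuous
    have e : ENNReal.ofReal (g t') = ∫⁻ y in ball x r, ‖u t' y‖ₑ ^ 2 := by
      rw [hg, ← lintegral_closedBall_eq_ofReal_integral hcont x r, setLIntegral_closedBall_eq_ball]
    have h2 : ENNReal.ofReal (g t') ≤ ENNReal.ofReal (C * A * r) := by rw [e]; exact ht'
    exact (ENNReal.ofReal_le_ofReal_iff (by positivity)).1 h2
  have hgt : g t ≤ C * A * r := le_of_ae_le_of_continuousOn_Icc ht₀t hgc hae t (right_mem_Icc.2 ht₀t.le)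
  have hcont_t : Continuous (u t) := (hcl.contDiff_velocity ⟨(ht₀.1.trans ht₀t).le, ht.2⟩).continuous
  calc ∫⁻ y in ball x r, ‖u t y‖ₑ ^ 2 = ∫⁻ y in closedBall x r, ‖u t y‖ₑ ^ 2 :=
        (setLIntegral_closedBall_eq_ball _ x r).symm
    _ = ENNReal.ofReal (g t) := lintegral_closedBall_eq_ofReal_integral hcont_t x r
    _ ≤ ENNReal.ofReal (C * A * r) := ENNReal.ofReal_le_ofReal hgt
    _ ≤ ENNReal.ofReal (max (C : ℝ) 1 * A * r) := by
        refine ENNReal.ofReal_le_ofReal ?_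
        have : (C : ℝ) * (A * r) ≤ max (C : ℝ) 1 * (A * r) := mul_le_mul_of_nonneg_right hC₁ (by positivity)
        linarith

/-- **Concentration has a past** (the contrapositive, backward form).  With the constants of
`exists_scaledEnergy_modulation`: if at a time `t ∈ (0,T)` some ball of radius `r` carries
`∫_{B(x,r)} |u(t)|² > C₁ A r`, then at EVERY earlier time `t₀ ∈ (0, t]` with `t - t₀ < ε₁ r² min(ν⁻¹, ν³/A²)`
some ball of the same radius already carried `∫_{B(x',r)} |u(t₀)|² > A r`. -/
theorem exists_scaledEnergy_backward :
    ∃ ε₁ : ℝ, 0 < ε₁ ∧ ∃ C₁ : ℝ, 1 ≤ C₁ ∧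
      ∀ (ν T : ℝ), 0 < ν → 0 < T →
      ∀ (u : ℝ → EuclideanSpace ℝ (Fin 3) → EuclideanSpace ℝ (Fin 3)) (p : ℝ → EuclideanSpace ℝ (Fin 3) → ℝ),
        IsClassicalNSSolutionOn (Ico 0 T) ν 0 u p → IsLerayHopfOn T ν 0 (u 0) u → HasRapidSpatialDecay (u 0) →
        ∀ t ∈ Ioo 0 T, ∀ r : ℝ, 0 < r → ∀ A : ℝ, 0 < A →
          (∃ x : EuclideanSpace ℝ (Fin 3), ENNReal.ofReal (C₁ * A * r) < ∫⁻ y in ball x r, ‖u t y‖ₑ ^ 2) →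
          ∀ t₀ ∈ Ioc 0 t, t - t₀ < ε₁ * r ^ 2 * min ν⁻¹ (ν ^ 3 / A ^ 2) →
            ∃ x : EuclideanSpace ℝ (Fin 3), ENNReal.ofReal (A * r) < ∫⁻ y in ball x r, ‖u t₀ y‖ₑ ^ 2 := by
  obtain ⟨ε₁, hε₁, C₁, hC₁, h⟩ := exists_scaledEnergy_modulation
  refine ⟨ε₁, hε₁, C₁, hC₁, ?_⟩
  intro ν T hν hT u p hcl hLH hdec t ht r hr A hA hbig t₀ ht₀ hτ
  by_contra hno
  push Not at hno
  obtain ⟨x, hx⟩ := hbig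
  have hb := h ν T hν hT u p hcl hLH hdec t₀ ⟨ht₀.1, lt_of_le_of_lt ht₀.2 ht.2⟩ r hr A hA hno t ⟨ht₀.2, ht.2⟩ hτ x
  exact (lt_irrefl _) (hx.trans_le hb)

end Summit.NavierStokesRegularity.NavierStokesRegularity.Theorems.L3TimeExponentPincerScaledEnergyModulation

end
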